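import Mathlib
import Literature.AlgebraicGeometry.Resolution.CobordantBlowupAlgebra
import Literature.AlgebraicGeometry.Resolution.CobordantBlowupRegular
import Summits.ResolutionOfSingularities.ResolutionOfSingularities.Theses.WeightedInvariant

/-!
# `WeightedThesis` — the strict transform of a hypersurface under a cobordant blow-up is a hypersurface

Support lemma for crux `stmt-ResolutionOfSingularities-0569`
(`Summit.ResolutionOfSingularities.ResolutionOfSingularities.Theses.WeightedInvariant.WeightedThesis`),
line `datum-glued-split` (RESHAPE 2), stub `stub_datumToHypersurfaceNonminimal`: the reshape of
cycle 2 needs the weighted resolution datum ONLY for locally principal ideal sheaves, which is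
legitimate because the class of hypersurfaces is stable under the datum's own move — on the
cobordant blow-up the strict transform of a principal ideal is again principal. Włodarczyk
(arXiv:2203.03090, 3.3.12 with 2.3.9) gets this from the regularity of `B` (regular local rings are
factorial); Mathlib has no Auslander–Buchsbaum, so this file proves the affine statement directly
from the PRIMALITY of the exceptional parameter `s = t⁻¹`:

* `dvd_of_dvd_prime_pow_mul` — in a commutative domain, if `s` is prime, `s ∤ f₁` and
  `f₁ ∣ sⁿ g`, then `f₁ ∣ g`;
* `cobordantAlgebra.prime_s_of_isPrime_span` — in the affine model `𝒪_B = A[t⁻¹, uᵢ t^{wᵢ}]` over a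
  domain `A`, with positive weights and `u` weighted quasi-regular, `s` is a prime element as soon as
  the centre `(u)` is a prime ideal (`𝒪_B/(s) ≅ (A/(u))[X]`, `cobordantAlgebra.nonempty_quotient_span_s_equiv`);
* `stub_strictTransform_span_singleton_isPrincipal` — **under these hypotheses, for `A` a
  Noetherian domain, the strict transform `σˢ((f)) = ((f)·𝒪_B : s^∞)` of every principal ideal is
  principal**: `f = sᵃ f₁` with `s ∤ f₁` (finite multiplicity in the Noetherian domain `𝒪_B`) and
  `σˢ((f)) = (f₁)`.

On a scheme this is used chart by chart, after shrinking the affine chart so that it meets one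
component of the (regular, hence locally integral) centre; there `(u)` is prime.
No definition is declared.
-/

noncomputable section

open scoped LaurentPolynomial
open LaurentPolynomial
open Literature.AlgebraicGeometry.Resolution

set_option linter.dupNamespace false

namespace Summit.ResolutionOfSingularities.ResolutionOfSingularities.Theorems.WeightedThesis.PrincipalStrictTransform

universe u v

/-! ## A divisibility lemma -/

/-- In a commutative domain: if `s` is prime, `s ∤ f₁` and `f₁ ∣ sⁿ g`, then `f₁ ∣ g`. [folklore] -/
theorem dvd_of_dvd_prime_pow_mul {B : Type u} [CommRing B] [IsDomain B] {s f₁ : B} (hs : Prime s)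
    (hsf : ¬ s ∣ f₁) : ∀ (n : ℕ) (g : B), f₁ ∣ s ^ n * g → f₁ ∣ g := by
  intro n
  induction n with
  | zero => intro g h; simpa using h
  | succ n ih =>
    intro g h
    obtain ⟨c, hc⟩ := h
    -- `s ∣ f₁ c`, hence `s ∣ c`
    have hsc : s ∣ f₁ * c := ⟨s ^ n * g, by rw [← hc]; ring⟩
    rcases hs.dvd_or_dvd hsc with h1 | ⟨c', rfl⟩
    · exact absurd h1 hsf
    · refine ih g ⟨c', ?_⟩
      have h' : s * (s ^ n * g) = s * (f₁ * c') := by rw [← mul_assoc, ← pow_succ', hc]; ring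
      exact mul_left_cancel₀ hs.ne_zero h'

/-! ## The exceptional parameter is prime over a prime centre -/

section Affine

variable {A : Type u} [CommRing A] {ι : Type v} (u : ι → A) (w : ι → ℕ)

/-- **`s = t⁻¹` is a prime element of `𝒪_B = A[t⁻¹, uᵢ t^{wᵢ}]` when the centre `(u)` is a prime
ideal** (`A` a domain, positive weights, `u` weighted quasi-regular): `𝒪_B/(s) ≅ (A/(u))[Xᵢ]` is a
domain. [cite: Wlodarczyk2022, §2.3.9 and §4.1] -/
theorem cobordantAlgebra.prime_s_of_isPrime_span [IsDomain A] [DecidableEq ι] (hw : ∀ i, 0 < w i)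
    (hwqr : ∀ (n : ℕ) (P : MvPolynomial ι A), P.IsWeightedHomogeneous w n →
      MvPolynomial.eval u P ∈ (weightedFiltration u w).ideal (n + 1) →
        ∀ β, P.coeff β ∈ Ideal.span (Set.range u))
    (hprime : (Ideal.span (Set.range u)).IsPrime) :
    Prime (cobordantAlgebra.s u w) := by
  have hs0 : cobordantAlgebra.s u w ≠ 0 :=
    nonZeroDivisors.ne_zero (cobordantAlgebra.s_mem_nonZeroDivisors u w)
  rw [← Ideal.span_singleton_prime hs0]
  obtain ⟨e⟩ := cobordantAlgebra.nonempty_quotient_span_s_equiv u w hw hwqr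
  haveI : IsDomain (A ⧸ Ideal.span (Set.range u)) := (Ideal.Quotient.isDomain_iff_prime _).mpr hprime
  haveI : IsDomain (cobordantAlgebra u w ⧸ Ideal.span {cobordantAlgebra.s u w}) :=
    e.toMulEquiv.isDomain
  exact (Ideal.Quotient.isDomain_iff_prime _).mp inferInstance

/-! ## The strict transform of a principal ideal is principal -/

/-- If `f = sᵃ f₁` in `𝒪_B` with `s` prime and `s ∤ f₁`, the strict transform of `(f)` is `(f₁)`.
[cite: Wlodarczyk2022, 3.3.12] -/
theorem cobordantAlgebra.strictTransform_span_singleton_eq [IsDomain A] (hs : Prime (cobordantAlgebra.s u w))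
    {f : A} {a : ℕ} {f₁ : cobordantAlgebra u w}
    (hf : algebraMap A (cobordantAlgebra u w) f = cobordantAlgebra.s u w ^ a * f₁)
    (hsf : ¬ cobordantAlgebra.s u w ∣ f₁) :
    cobordantAlgebra.strictTransform u w (Ideal.span {f}) = Ideal.span {f₁} := by
  apply le_antisymm
  · intro g hg
    obtain ⟨n, hn⟩ := (cobordantAlgebra.mem_strictTransform_iff u w).mp hg
    rw [Ideal.map_span, Set.image_singleton, hf, Ideal.mem_span_singleton] at hn
    rw [Ideal.mem_span_singleton]
    refine dvd_of_dvd_prime_pow_mul hs hsf n g ?_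
    exact (Dvd.intro_left _ rfl : f₁ ∣ cobordantAlgebra.s u w ^ a * f₁).trans hn
  · rw [Ideal.span_singleton_le_iff_mem, cobordantAlgebra.mem_strictTransform_iff]
    refine ⟨a, ?_⟩
    rw [Ideal.map_span, Set.image_singleton, hf]
    exact Ideal.subset_span rfl

/-- **The strict transform of a principal ideal under the full cobordant blow-up is principal**
(affine model; `A` a Noetherian domain, positive weights, `u` weighted quasi-regular with prime
centre `(u)`): `σˢ((f)) = ((f) 𝒪_B : s^∞)` is generated by `f₁` where `f = sᵃ f₁`, `s ∤ f₁` —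
so on the cobordant blow-up the strict transform of a hypersurface is again a hypersurface, which
keeps the weighted algorithm inside codimension one. [cite: Wlodarczyk2022, 3.3.12 and 2.3.9] -/
theorem stub_strictTransform_span_singleton_isPrincipal :
    ∀ {A : Type} [CommRing A] [IsDomain A] [IsNoetherianRing A] {m : ℕ} (u : Fin m → A) (w : Fin m → ℕ), (∀ i, 0 < w i) → (∀ (n : ℕ) (P : MvPolynomial (Fin m) A), P.IsWeightedHomogeneous w n → MvPolynomial.eval u P ∈ (Literature.AlgebraicGeometry.Resolution.weightedFiltration u w).ideal (n + 1) → ∀ β, P.coeff β ∈ Ideal.span (Set.range u)) → (Ideal.span (Set.range u)).IsPrime → ∀ f : A, (Literature.AlgebraicGeometry.Resolution.cobordantAlgebra.strictTransform u w (Ideal.span {f})).IsPrincipal := by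
  intro A _ _ _ m u w hw hwqr hprime f
  have hs := cobordantAlgebra.prime_s_of_isPrime_span u w hw hwqr hprime
  haveI : IsNoetherianRing (cobordantAlgebra u w) := cobordantAlgebra.isNoetherianRing u w
  by_cases hf0 : algebraMap A (cobordantAlgebra u w) f = 0
  · -- `f = 0` in `𝒪_B`: the strict transform is `0` (`𝒪_B` is a domain and `s ≠ 0`)
    refine ⟨⟨0, ?_⟩⟩
    rw [Ideal.submodule_span_eq, Ideal.span_singleton_zero, eq_bot_iff]
    intro g hg
    obtain ⟨n, hn⟩ := (cobordantAlgebra.mem_strictTransform_iff u w).mp hg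
    rw [Ideal.map_span, Set.image_singleton, hf0, Ideal.span_singleton_zero, Ideal.mem_bot] at hn
    exact (Ideal.mem_bot).mpr ((mul_eq_zero.mp hn).resolve_left (pow_ne_zero n hs.ne_zero))
  · obtain ⟨f₁, hf₁, hsf₁⟩ :=
      (FiniteMultiplicity.of_prime_left hs hf0).exists_eq_pow_mul_and_not_dvd
    exact ⟨⟨f₁, by rw [cobordantAlgebra.strictTransform_span_singleton_eq u w hs hf₁ hsf₁,
      Ideal.submodule_span_eq]⟩⟩

end Affine

end Summit.ResolutionOfSingularities.ResolutionOfSingularities.Theorems.WeightedThesis.PrincipalStrictTransform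

end
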